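import Summits.QuantumFields.YangMills.Theorems.VirialFluxGapRegularValleyQuaternion
import Summits.QuantumFields.YangMills.Theorems.ToronValleyVolumeLojasiewiczLocaliseRing
import HarnessLib

/-!
# Route `VirialFluxGap` (YangMills): REGULAR-VALLEY LINEAR LOCALISATION of the periodic ring deficit — quadratic growth of `F₀` transverse to the
# toron valley AWAY from the central torons, in chart-free Łojasiewicz form

Toward the deciding crux `VirialFluxGap.PeriodicSoftness` (item stmt-QuantumFields-24141).  Both Euler-field routes (IBP: LEAD g92 ∕ w3 g58; volume
scaling: ✓`VolumeScaling.periodicSoftness_of_scaling` ∕ `_of_robustScaling`) need, on the REGULAR part of the toron valley (holonomies away from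
`±1`), the Morse–Bott coercivity that absorbs cubic Taylor remainders.  ✓`Lojasiewicz.lojasiewiczLocalise_holds` (⟨24498⟩, fcl-p3 g33) gives the
GLOBAL law `dist ≤ 5000L⁸·F₀^{1/2}` (exponent `½`, forced by the commutator cone at the 16 central torons); this file proves the exponent-ONE law
away from the centre, with the SAME skeleton and the linear algebraic input ✓`RegularValley.exists_commuting_near_of_norm_comm_le_of_far`:

* `exists_flat_ring_near_of_far` — if the comb data of `P` (the three wrap representatives `wrapReps(P₀)` of slice `0` in comb gauge and the seam
  value `P.2 0`) contain ONE element with `|Im q|² ≥ ρ²`, there is a flat ring `Q` (`F₀(Q) = 0`) with every slice link within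
  `4L√F₀ + 12L²√F₀ + 40L²√F₀/ρ` and every seam variable within `12L²√F₀ + 40L²√F₀/ρ` of `P` (Frobenius);
* ★★ `regular_linear_localise` — for such `P`: `dist(P, {F₀ = 0}) ≤ 21520·L⁸·F₀(P)/ρ²` (the inlined squared chordal ring distance of ⟨24497⟩∕⟨24498⟩),
  i.e. `F₀ ≥ ρ²·dist/(21520L⁸)`: QUADRATIC GROWTH transverse to the valley with the expected `ρ²` degeneration towards the centre
  (regularity stated on `1 − re(q)²`, a class function of the wrap ∕ seam holonomies).

HONEST FRAMING: a classical (zero-ℏ) inequality for the lattice Wilson action on `L³ × 2L`; the Euler field itself, ⟨24141⟩, ⟨24497⟩, every rung and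
the Yang–Mills mass gap remain OPEN; no summit is proved by a line.  ROUTE-INDEPENDENT (no `Theses` import).  THEOREMS ONLY (no definition,
no `sorry`), standard axioms.  Width seat
`ym-line-sfw-p2-w2` g51 (cell ym-idea-1, free hands), `--supports stmt-QuantumFields-24141`.  References: [cite: Luscher1983, §2].
-/

set_option autoImplicit false

noncomputable section

open scoped Quaternion Matrix BigOperators
open Literature.MathematicalPhysics.QuantumFieldTheory hiding SU2
open Literature.MathematicalPhysics.QuantumLattice

namespace Summit.QuantumFields.YangMills.Theorems.VirialFluxGap.RegularValley

open Summit.QuantumFields.YangMills.Theorems.FemtoTransferGap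
open Summit.QuantumFields.YangMills.Theorems.FemtoTransferGap.TT
open Summit.QuantumFields.YangMills.Theorems.FemtoTransferGap.TT.SectorSmooth
open Summit.QuantumFields.YangMills.Theorems.FemtoTransferGap.TwoLattice
open Summit.QuantumFields.YangMills.Theorems.FemtoTransferGap.TwoLattice.Flat
open Summit.QuantumFields.YangMills.Theorems.FemtoTransferGap.TwoLattice.Cov
open Summit.QuantumFields.YangMills.Theorems.VirialFluxGap.RingDeficit
open Summit.QuantumFields.YangMills.Theorems.ToronValleyVolume.Lojasiewicz

variable {L : ℕ} [NeZero L]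

/-! ## §1 ★ The flat comparison ring near a REGULAR ring history -/

/-- ★ **A flat ring history LINEARLY near every regular small-deficit ring history.**  With `δ = √F₀(P)`: if one of the wrap representatives
`wrapReps(P₀)_k` or the seam value `P.2 0` has `|Im q|² ≥ ρ² > 0`, there is a ring history `Q` with `F₀(Q) = 0` whose slices are within
`4Lδ + 12L²δ + 40L²δ/ρ` of the slices of `P` on every link (Frobenius) and whose seam field is within `12L²δ + 40L²δ/ρ` of the seam field of `P`
at every site. [cite: Luscher1983, §2] -/
theorem exists_flat_ring_near_of_far (P : (Fin (2 * L - 1 + 1) → GaugeConfig 3 L SU2) × (Site 3 L → SU2)) {ρ : ℝ} (hρ : 0 < ρ)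
    (hfar : (∃ k : Fin 3, ρ ^ 2 ≤ ((su2Quat (wrapReps (P.1 0) k)).imI * (su2Quat (wrapReps (P.1 0) k)).imI +
        (su2Quat (wrapReps (P.1 0) k)).imJ * (su2Quat (wrapReps (P.1 0) k)).imJ + (su2Quat (wrapReps (P.1 0) k)).imK * (su2Quat (wrapReps (P.1 0) k)).imK)) ∨
      ρ ^ 2 ≤ ((su2Quat (P.2 0)).imI * (su2Quat (P.2 0)).imI + (su2Quat (P.2 0)).imJ * (su2Quat (P.2 0)).imJ +
        (su2Quat (P.2 0)).imK * (su2Quat (P.2 0)).imK)) :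
    ∃ Q : (Fin (2 * L - 1 + 1) → GaugeConfig 3 L SU2) × (Site 3 L → SU2),
      ringDeficit L (fun _ => false) Q = 0 ∧
      (∀ (i : Fin (2 * L - 1 + 1)) (e : Edge 3 L), fd (P.1 i e) (Q.1 i e) ≤
        4 * (L : ℝ) * Real.sqrt (ringDeficit L (fun _ => false) P) + 12 * (L : ℝ) ^ 2 * Real.sqrt (ringDeficit L (fun _ => false) P) +
          40 * (L : ℝ) ^ 2 * Real.sqrt (ringDeficit L (fun _ => false) P) / ρ) ∧
      (∀ x : Site 3 L, fd (P.2 x) (Q.2 x) ≤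
        12 * (L : ℝ) ^ 2 * Real.sqrt (ringDeficit L (fun _ => false) P) + 40 * (L : ℝ) ^ 2 * Real.sqrt (ringDeficit L (fun _ => false) P) / ρ) := by
  set δ := Real.sqrt (ringDeficit L (fun _ => false) P) with hδ
  have hδ0 : 0 ≤ δ := Real.sqrt_nonneg _
  have hL1 : (1 : ℝ) ≤ L := by exact_mod_cast NeZero.one_le
  have hL0 : (0 : ℝ) ≤ (L : ℝ) - 1 := by linarith
  set U : GaugeConfig 3 L SU2 := P.1 0 with hU
  set g : Site 3 L → SU2 := P.2 with hg
  set ρ' : ℝ := 4 * (L : ℝ) * δ with hρ'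
  have hρ'0 : 0 ≤ ρ' := by positivity
  -- inputs from `…LocaliseRing` §2
  have hslice : ∀ i e, fd (P.1 i e) (U e) ≤ 4 * (L : ℝ) * δ := fun i e => fd_slice_zero_le' P i e
  have hseam : ∀ e, fd (U e) (gaugeTransform g U e) ≤ ρ' := fun e => fd_seam_zero_le P e
  have hS : Real.sqrt (2 * wilsonAction su2Rep U) ≤ 2 * δ := sqrt_two_action_le P
  -- comb gauge of slice 0
  set t : Site 3 L → SU2 := treeGauge U with ht
  have hV : treeFix U = gaugeTransform t U := rfl
  set w : Fin 3 → SU2 := wrapReps U with hw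
  have hVw : ∀ e, fd (treeFix U e) (combFlat w e) ≤ 12 * (L : ℝ) ^ 2 * δ := fun e => by
    refine (fd_treeFix_combFlat_le U e).trans ?_
    have h1 : ((L : ℝ) - 1) * ((6 * (L : ℝ) - 4) * Real.sqrt (2 * wilsonAction su2Rep U)) ≤ ((L : ℝ) - 1) * ((6 * (L : ℝ) - 4) * (2 * δ)) :=
      mul_le_mul_of_nonneg_left (mul_le_mul_of_nonneg_left hS (by linarith)) hL0
    nlinarith [h1]
  have hww : ∀ i j, fd (w i * w j * (w i)⁻¹ * (w j)⁻¹) 1 ≤ 20 * (L : ℝ) ^ 2 * δ := fun i j => by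
    refine (fd_comm_wrapReps_le U i j).trans ?_
    have hC : combC L ≤ 10 * (L : ℝ) ^ 2 := by unfold combC; nlinarith
    have hC0 : 0 ≤ combC L := le_trans zero_le_one one_le_combC
    calc combC L * Real.sqrt (2 * wilsonAction su2Rep U) ≤ combC L * (2 * δ) := mul_le_mul_of_nonneg_left hS hC0
      _ ≤ 10 * (L : ℝ) ^ 2 * (2 * δ) := mul_le_mul_of_nonneg_right hC (by positivity)
      _ = 20 * (L : ℝ) ^ 2 * δ := by ring
  -- the conjugated seam field nearly stabilises the comb-gauge slice
  set s : Site 3 L → SU2 := fun x => t x * g x * (t x)⁻¹ with hs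
  have hsV : ∀ e, fd (treeFix U e) (gaugeTransform s (treeFix U) e) ≤ ρ' := fun e => by
    rw [hV, hs, gaugeTransform_conj_eq, fd_gaugeTransform_apply]; exact hseam e
  have hjump : ∀ e : Edge 3 L, treeEdge e = true → fd (s (e.1.shift e.2)) (s e.1) ≤ ρ' := by
    intro e he
    have h1 := hsV e
    rw [treeFix_eq_one_of_treeEdge U he] at h1
    have e1 : gaugeTransform s (treeFix U) e = s e.1 * (s (e.1.shift e.2))⁻¹ := by
      rw [show gaugeTransform s (treeFix U) e = s e.1 * treeFix U e * (s (e.1.shift e.2))⁻¹ from rfl, treeFix_eq_one_of_treeEdge U he, mul_one]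
    rw [e1, fd_comm, fd_mul_inv_one] at h1
    rwa [fd_comm]
  set c : SU2 := s 0 with hc
  have hcg : c = g 0 := by rw [hc, hs]; dsimp only; rw [ht, treeGauge_zero, one_mul, inv_one, mul_one]
  have hsc : ∀ x, fd (s x) c ≤ 3 * ((L : ℝ) - 1) * ρ' := fun x => by
    have := fd_sub_base_le_of_treeEdge hρ'0 hjump x
    rwa [hc]
  have hcw : ∀ k : Fin 3, fd (c * w k * c⁻¹ * (w k)⁻¹) 1 ≤ 12 * (L : ℝ) ^ 2 * δ := by
    intro k
    set m : Site 3 L := mk3 (if k = 0 then (-1 : ZMod L) else 0) (if k = 1 then (-1 : ZMod L) else 0) (if k = 2 then (-1 : ZMod L) else 0) with hm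
    have hwk : w k = treeFix U (m, k) := by rw [hw, wrapReps_eq]
    have hshift : m.shift k = 0 := wrapEdge_shift k
    have h1 := hsV (m, k)
    have e1 : gaugeTransform s (treeFix U) (m, k) = s m * treeFix U (m, k) * c⁻¹ := by
      rw [show gaugeTransform s (treeFix U) (m, k) = s m * treeFix U (m, k) * (s (m.shift k))⁻¹ from rfl, hshift]
    rw [e1, ← hwk] at h1
    have h2 : fd (s m * w k * c⁻¹) (c * w k * c⁻¹) = fd (s m) c := by rw [fd_mul_right, fd_mul_right]
    have h3 := hsc m
    rw [fd_mul_inv_one, fd_comm]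
    calc fd (w k) (c * w k * c⁻¹) ≤ fd (w k) (s m * w k * c⁻¹) + fd (s m * w k * c⁻¹) (c * w k * c⁻¹) := fd_triangle _ _ _
      _ ≤ ρ' + 3 * ((L : ℝ) - 1) * ρ' := by rw [h2]; exact add_le_add h1 h3
      _ ≤ 12 * (L : ℝ) ^ 2 * δ := by rw [hρ']; nlinarith
  -- the quadruple (wraps, c) almost commutes
  let X : Option (Fin 3) → SU2 := fun o => Option.elim o c w
  have hXs : ∀ k : Fin 3, X (some k) = w k := fun k => rfl
  have hXn : X none = c := rfl
  have hinv : ∀ a b : SU2, fd (b * a * b⁻¹ * a⁻¹) 1 = fd (a * b * a⁻¹ * b⁻¹) 1 := fun a b => by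
    rw [show b * a * b⁻¹ * a⁻¹ = (a * b * a⁻¹ * b⁻¹)⁻¹ by group, ← fd_inv, inv_inv, inv_one]
  have hcomm : ∀ i j, ‖su2Quat (X i) * su2Quat (X j) - su2Quat (X j) * su2Quat (X i)‖ ≤ 20 * (L : ℝ) ^ 2 * δ := by
    intro i j
    refine (norm_quat_comm_le_fd (X i) (X j)).trans ?_
    rcases i with _ | i <;> rcases j with _ | j
    · rw [hXn, mul_inv_cancel_right, mul_inv_cancel, fd_self]; positivity
    · rw [hXn, hXs]; exact (hcw j).trans (by nlinarith)
    · rw [hXn, hXs, hinv]; exact (hcw i).trans (by nlinarith)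
    · rw [hXs, hXs]; exact hww i j
  have hη0 : 0 ≤ 20 * (L : ℝ) ^ 2 * δ := by positivity
  -- the REGULAR pivot
  obtain ⟨o₀, ho₀⟩ : ∃ o₀ : Option (Fin 3), ρ ^ 2 ≤ ((su2Quat (X o₀)).imI * (su2Quat (X o₀)).imI +
      (su2Quat (X o₀)).imJ * (su2Quat (X o₀)).imJ + (su2Quat (X o₀)).imK * (su2Quat (X o₀)).imK) := by
    rcases hfar with ⟨k, hk⟩ | h0
    · exact ⟨some k, by rw [hXs, hw, hU]; exact hk⟩
    · exact ⟨none, by rw [hXn, hcg, hg]; exact h0⟩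
  obtain ⟨y, hy1, hyc, hyd⟩ := exists_commuting_near_of_norm_comm_le_of_far (fun o => su2Quat (X o)) hη0 hρ (fun o => norm_su2Quat _) hcomm o₀ ho₀
  obtain ⟨Y, hYq, hYc⟩ := exists_su2_family_of_unit_quaternions y hy1
  have hYcomm : ∀ i j, Y i * Y j = Y j * Y i := fun i j => hYc i j (hyc i j)
  have hXY : ∀ o, fd (X o) (Y o) ≤ 40 * (L : ℝ) ^ 2 * δ / ρ := fun o => by
    refine (fd_le_two_mul_norm_su2Quat_sub (X o) (Y o)).trans ?_
    rw [hYq]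
    have := hyd o
    have e : 40 * (L : ℝ) ^ 2 * δ / ρ = 2 * (20 * (L : ℝ) ^ 2 * δ / ρ) := by ring
    rw [e]; linarith
  -- the flat ring
  set h' : Fin 3 → SU2 := fun k => Y (some k) with hh'
  set c' : SU2 := Y none with hc'
  have hh'c : ∀ i j, h' i * h' j = h' j * h' i := fun i j => hYcomm _ _
  have hc'h : ∀ k, c' * h' k = h' k * c' := fun k => hYcomm _ _
  set F : GaugeConfig 3 L SU2 := combFlat h' with hF
  have hSF : wilsonAction su2Rep F = 0 := wilsonAction_combFlat_eq_zero hh'c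
  refine ⟨(fun _ => gaugeTransform t⁻¹ F, fun x => (t x)⁻¹ * c' * t x), ?_, ?_, ?_⟩
  · -- deficit zero
    rw [ringDeficit_eq_sums, twist3_false]
    dsimp only
    have hseamQ : gaugeTransform (fun x => (t x)⁻¹ * c' * t x) (gaugeTransform t⁻¹ F) = gaugeTransform t⁻¹ F := by
      rw [gaugeTransform_gaugeTransform]
      have e1 : ((fun x => (t x)⁻¹ * c' * t x) * t⁻¹ : Site 3 L → SU2) = t⁻¹ * fun _ => c' := by
        funext x; simp only [Pi.mul_apply, Pi.inv_apply, mul_inv_cancel_right]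
      rw [e1, ← gaugeTransform_gaugeTransform, gaugeTransform_const_combFlat_of_comm hc'h]
    rw [hseamQ, timeCoupling_deficit_self, wilsonAction_gaugeTransform, hSF]
    simp
  · -- slices
    intro i e
    have e1 : fd (P.1 i e) (gaugeTransform t⁻¹ F e) = fd (gaugeTransform t (P.1 i) e) (F e) := by
      have h := fd_gaugeTransform_apply t (P.1 i) (gaugeTransform t⁻¹ F) e
      rw [gaugeTransform_gaugeTransform_inv] at h
      exact h.symm
    rw [e1]
    have h1 : fd (gaugeTransform t (P.1 i) e) (gaugeTransform t U e) ≤ 4 * (L : ℝ) * δ := by rw [fd_gaugeTransform_apply]; exact hslice i e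
    have h2 := hVw e
    have h3 : fd (combFlat w e) (F e) ≤ 40 * (L : ℝ) ^ 2 * δ / ρ := by
      rw [hF, combFlat_apply, combFlat_apply]
      split_ifs with hx
      · have := hXY (some e.2); rwa [hXs] at this
      · rw [fd_self]; positivity
    calc fd (gaugeTransform t (P.1 i) e) (F e)
        ≤ fd (gaugeTransform t (P.1 i) e) (gaugeTransform t U e) + (fd (gaugeTransform t U e) (combFlat w e) + fd (combFlat w e) (F e)) :=
          (fd_triangle _ _ _).trans (add_le_add le_rfl (fd_triangle _ _ _))
      _ ≤ 4 * (L : ℝ) * δ + (12 * (L : ℝ) ^ 2 * δ + 40 * (L : ℝ) ^ 2 * δ / ρ) := add_le_add h1 (add_le_add (hV ▸ h2) h3)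
      _ = 4 * (L : ℝ) * δ + 12 * (L : ℝ) ^ 2 * δ + 40 * (L : ℝ) ^ 2 * δ / ρ := by ring
  · -- seam
    intro x
    have e0 : t x * ((t x)⁻¹ * c' * t x) * (t x)⁻¹ = c' := by
      simp only [mul_assoc, mul_inv_cancel_left, mul_inv_cancel, mul_one]
    have e1 : fd (g x) ((t x)⁻¹ * c' * t x) = fd (s x) c' := by
      rw [hs]; dsimp only
      conv_rhs => rw [← e0]
      rw [fd_mul_right, fd_mul_left]
    rw [e1]
    have h1 := hsc x
    have h2 : fd c c' = fd (X none) (Y none) := rfl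
    have h3 := hXY none
    calc fd (s x) c' ≤ fd (s x) c + fd c c' := fd_triangle _ _ _
      _ ≤ 3 * ((L : ℝ) - 1) * ρ' + 40 * (L : ℝ) ^ 2 * δ / ρ := add_le_add h1 (h2 ▸ h3)
      _ ≤ 12 * (L : ℝ) ^ 2 * δ + 40 * (L : ℝ) ^ 2 * δ / ρ := by rw [hρ']; nlinarith

/-! ## §2 ★★ Quadratic growth transverse to the regular valley -/

/-- Constants: with `0 < ρ ≤ 1`, `δ ≥ 0`, `B₁ = 4Lδ + 12L²δ + 40L²δ/ρ`, `B₂ = 12L²δ + 40L²δ/ρ`: `2L·3L³·B₁² + L³·B₂² ≤ 21520·L⁸·δ²/ρ²`. [folklore] -/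
theorem constants_arith_far {Lr δ ρ : ℝ} (hL : 1 ≤ Lr) (hδ0 : 0 ≤ δ) (hρ0 : 0 < ρ) (hρ1 : ρ ≤ 1) :
    2 * Lr * (3 * Lr ^ 3) * (4 * Lr * δ + 12 * Lr ^ 2 * δ + 40 * Lr ^ 2 * δ / ρ) ^ 2 +
      Lr ^ 3 * (12 * Lr ^ 2 * δ + 40 * Lr ^ 2 * δ / ρ) ^ 2 ≤ 21520 * Lr ^ 8 * δ ^ 2 / ρ ^ 2 := by
  have hL0 : 0 < Lr := by linarith
  set u : ℝ := Lr ^ 2 * δ / ρ with hu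
  have hu0 : 0 ≤ u := by positivity
  -- `L δ ≤ L² δ ≤ L² δ / ρ`
  have h1 : Lr * δ ≤ u := by
    rw [hu, le_div_iff₀ hρ0]
    have : Lr * δ * ρ ≤ Lr * δ * 1 := mul_le_mul_of_nonneg_left hρ1 (by positivity)
    nlinarith [mul_le_mul_of_nonneg_right (show Lr ≤ Lr ^ 2 by nlinarith) hδ0]
  have h2 : Lr ^ 2 * δ ≤ u := by
    rw [hu, le_div_iff₀ hρ0]
    exact mul_le_of_le_one_right (by positivity) hρ1
  have hB1 : 4 * Lr * δ + 12 * Lr ^ 2 * δ + 40 * Lr ^ 2 * δ / ρ ≤ 56 * u := by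
    have e : 40 * Lr ^ 2 * δ / ρ = 40 * u := by rw [hu]; ring
    rw [e]; linarith
  have hB2 : 12 * Lr ^ 2 * δ + 40 * Lr ^ 2 * δ / ρ ≤ 52 * u := by
    have e : 40 * Lr ^ 2 * δ / ρ = 40 * u := by rw [hu]; ring
    rw [e]; linarith
  have hB10 : 0 ≤ 4 * Lr * δ + 12 * Lr ^ 2 * δ + 40 * Lr ^ 2 * δ / ρ := by positivity
  have hB20 : 0 ≤ 12 * Lr ^ 2 * δ + 40 * Lr ^ 2 * δ / ρ := by positivity
  have hsq1 := pow_le_pow_left₀ hB10 hB1 2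
  have hsq2 := pow_le_pow_left₀ hB20 hB2 2
  have hu2 : u ^ 2 = Lr ^ 4 * δ ^ 2 / ρ ^ 2 := by rw [hu]; field_simp
  have hL3 : Lr ^ 3 ≤ Lr ^ 4 := pow_le_pow_right₀ hL (by norm_num)
  have hX0 : 0 ≤ Lr ^ 4 * δ ^ 2 / ρ ^ 2 := by positivity
  calc 2 * Lr * (3 * Lr ^ 3) * (4 * Lr * δ + 12 * Lr ^ 2 * δ + 40 * Lr ^ 2 * δ / ρ) ^ 2 +
        Lr ^ 3 * (12 * Lr ^ 2 * δ + 40 * Lr ^ 2 * δ / ρ) ^ 2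
      ≤ 2 * Lr * (3 * Lr ^ 3) * (56 * u) ^ 2 + Lr ^ 3 * (52 * u) ^ 2 :=
        add_le_add (mul_le_mul_of_nonneg_left hsq1 (by positivity)) (mul_le_mul_of_nonneg_left hsq2 (by positivity))
    _ = (18816 * Lr ^ 4 + 2704 * Lr ^ 3) * (Lr ^ 4 * δ ^ 2 / ρ ^ 2) := by rw [mul_pow, mul_pow, hu2]; ring
    _ ≤ (18816 * Lr ^ 4 + 2704 * Lr ^ 4) * (Lr ^ 4 * δ ^ 2 / ρ ^ 2) := mul_le_mul_of_nonneg_right (by linarith) hX0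
    _ = 21520 * Lr ^ 8 * δ ^ 2 / ρ ^ 2 := by ring

omit [NeZero L] in
/-- `|Im q(V)|² = 1 − re(q(V))²` for `V ∈ SU(2)`. [folklore] -/
theorem imDot_su2Quat_eq (V : SU2) :
    ((su2Quat V).imI * (su2Quat V).imI + (su2Quat V).imJ * (su2Quat V).imJ + (su2Quat V).imK * (su2Quat V).imK) = 1 - (su2Quat V).re ^ 2 := by
  have h := norm_sq_eq_re_sq_add_imDot (su2Quat V)
  rw [norm_su2Quat, one_pow] at h
  linarith

/-- ★★ **Regular-valley linear localisation (quadratic growth of `F₀` transverse to the toron valley away from the centre).**  For every `L ≥ 1`,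
`0 < ρ`, and every ring history `P` whose comb data are `ρ`-regular — some wrap representative `wrapReps(P₀)_k` of slice `0` or the seam value
`P.2 0` has `1 − re(q)² ≥ ρ²` —, the squared chordal ring distance from `P` to `{F₀ = 0}` is at most `21520·L⁸·F₀(P)/ρ²`. [cite: Luscher1983, §2] -/
theorem regular_linear_localise (P : (Fin (2 * L - 1 + 1) → GaugeConfig 3 L SU2) × (Site 3 L → SU2)) {ρ : ℝ} (hρ : 0 < ρ)
    (hfar : (∃ k : Fin 3, ρ ^ 2 ≤ 1 - (su2Quat (wrapReps (P.1 0) k)).re ^ 2) ∨ ρ ^ 2 ≤ 1 - (su2Quat (P.2 0)).re ^ 2) :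
    sInf ((fun Q : (Fin (2 * L - 1 + 1) → GaugeConfig 3 L SU2) × (Site 3 L → SU2) =>
        (∑ i : Fin (2 * L - 1 + 1), (6 * (L : ℝ) ^ 3 - timeCoupling su2Rep (P.1 i) (Q.1 i))) +
          ∑ x : Site 3 L, (2 - ((su2Rep (P.2 x * (Q.2 x)⁻¹)).trace).re)) ''
        {Q | ringDeficit L (fun _ => false) Q = 0}) ≤
      21520 * (L : ℝ) ^ 8 * ringDeficit L (fun _ => false) P / ρ ^ 2 := by
  set ε := ringDeficit L (fun _ => false) P with hε
  have hε0 : 0 ≤ ε := ringDeficit_nonneg _ _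
  have hL1 : (1 : ℝ) ≤ L := by exact_mod_cast NeZero.one_le
  set δ := Real.sqrt ε with hδ
  have hδ0 : 0 ≤ δ := Real.sqrt_nonneg _
  have hδ2 : δ ^ 2 = ε := Real.sq_sqrt hε0
  -- `ρ ≤ 1`: an imaginary mass is at most `1`
  have hρ1 : ρ ≤ 1 := by
    have hρ2 : ρ ^ 2 ≤ 1 := by
      rcases hfar with ⟨k, hk⟩ | h0
      · nlinarith [sq_nonneg (su2Quat (wrapReps (P.1 0) k)).re]
      · nlinarith [sq_nonneg (su2Quat (P.2 0)).re]
    nlinarith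
  -- the flat comparison ring
  have hfar' : (∃ k : Fin 3, ρ ^ 2 ≤ ((su2Quat (wrapReps (P.1 0) k)).imI * (su2Quat (wrapReps (P.1 0) k)).imI +
        (su2Quat (wrapReps (P.1 0) k)).imJ * (su2Quat (wrapReps (P.1 0) k)).imJ + (su2Quat (wrapReps (P.1 0) k)).imK * (su2Quat (wrapReps (P.1 0) k)).imK)) ∨
      ρ ^ 2 ≤ ((su2Quat (P.2 0)).imI * (su2Quat (P.2 0)).imI + (su2Quat (P.2 0)).imJ * (su2Quat (P.2 0)).imJ +
        (su2Quat (P.2 0)).imK * (su2Quat (P.2 0)).imK) := by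
    rcases hfar with ⟨k, hk⟩ | h0
    · exact Or.inl ⟨k, by rw [imDot_su2Quat_eq]; exact hk⟩
    · exact Or.inr (by rw [imDot_su2Quat_eq]; exact h0)
  obtain ⟨Q, hQ0, hQ1, hQ2⟩ := exists_flat_ring_near_of_far P hρ hfar'
  set B₁ := 4 * (L : ℝ) * δ + 12 * (L : ℝ) ^ 2 * δ + 40 * (L : ℝ) ^ 2 * δ / ρ with hB₁
  set B₂ := 12 * (L : ℝ) ^ 2 * δ + 40 * (L : ℝ) ^ 2 * δ / ρ with hB₂
  -- the value at `Q`
  have hval : (∑ i : Fin (2 * L - 1 + 1), (6 * (L : ℝ) ^ 3 - timeCoupling su2Rep (P.1 i) (Q.1 i))) +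
      ∑ x : Site 3 L, (2 - ((su2Rep (P.2 x * (Q.2 x)⁻¹)).trace).re) ≤ 21520 * (L : ℝ) ^ 8 * ε / ρ ^ 2 := by
    have hs1 : ∀ i : Fin (2 * L - 1 + 1), 6 * (L : ℝ) ^ 3 - timeCoupling su2Rep (P.1 i) (Q.1 i) ≤ 3 * (L : ℝ) ^ 3 * B₁ ^ 2 := fun i => by
      rw [timeCoupling_deficit_eq]
      calc ∑ e : Edge 3 L, ‖su2Quat (P.1 i e) - su2Quat (Q.1 i e)‖ ^ 2 ≤ ∑ _e : Edge 3 L, B₁ ^ 2 :=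
            Finset.sum_le_sum fun e _ => (pow_le_pow_left₀ (norm_nonneg _) (norm_su2Quat_sub_le_fd _ _) 2).trans (pow_le_pow_left₀ (frobNorm_nonneg _) (hQ1 i e) 2)
        _ = 3 * (L : ℝ) ^ 3 * B₁ ^ 2 := by rw [Finset.sum_const, Finset.card_univ, nsmul_eq_mul, ConstTube.card_edge_three L]
    have hs2 : ∀ x : Site 3 L, 2 - ((su2Rep (P.2 x * (Q.2 x)⁻¹)).trace).re ≤ B₂ ^ 2 := fun x => by
      rw [ConstTube.re_trace_su2Rep_mul_inv_eq_norm]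
      have := (pow_le_pow_left₀ (norm_nonneg _) (norm_su2Quat_sub_le_fd (P.2 x) (Q.2 x)) 2).trans (pow_le_pow_left₀ (frobNorm_nonneg _) (hQ2 x) 2)
      linarith
    have hcardI : (Fintype.card (Fin (2 * L - 1 + 1)) : ℝ) = 2 * (L : ℝ) := by
      rw [Fintype.card_fin]
      have hL : 1 ≤ L := NeZero.one_le
      rw [show 2 * L - 1 + 1 = 2 * L by omega]; push_cast; ring
    have hcardS : (Fintype.card (Site 3 L) : ℝ) = (L : ℝ) ^ 3 := by
      rw [Fintype.card_pi, Finset.prod_const, Finset.card_univ, Fintype.card_fin, ZMod.card]; push_cast; ring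
    have hA : (∑ i : Fin (2 * L - 1 + 1), (6 * (L : ℝ) ^ 3 - timeCoupling su2Rep (P.1 i) (Q.1 i))) ≤ 2 * (L : ℝ) * (3 * (L : ℝ) ^ 3) * B₁ ^ 2 := by
      calc (∑ i : Fin (2 * L - 1 + 1), (6 * (L : ℝ) ^ 3 - timeCoupling su2Rep (P.1 i) (Q.1 i))) ≤ ∑ _i : Fin (2 * L - 1 + 1), 3 * (L : ℝ) ^ 3 * B₁ ^ 2 :=
            Finset.sum_le_sum fun i _ => hs1 i
        _ = 2 * (L : ℝ) * (3 * (L : ℝ) ^ 3) * B₁ ^ 2 := by rw [Finset.sum_const, Finset.card_univ, nsmul_eq_mul, hcardI]; ring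
    have hB : ∑ x : Site 3 L, (2 - ((su2Rep (P.2 x * (Q.2 x)⁻¹)).trace).re) ≤ (L : ℝ) ^ 3 * B₂ ^ 2 := by
      calc ∑ x : Site 3 L, (2 - ((su2Rep (P.2 x * (Q.2 x)⁻¹)).trace).re) ≤ ∑ _x : Site 3 L, B₂ ^ 2 := Finset.sum_le_sum fun x _ => hs2 x
        _ = (L : ℝ) ^ 3 * B₂ ^ 2 := by rw [Finset.sum_const, Finset.card_univ, nsmul_eq_mul, hcardS]
    have harith := constants_arith_far hL1 hδ0 hρ hρ1
    rw [← hB₁, ← hB₂, hδ2] at harith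
    linarith
  -- `sInf ≤` the value at `Q`
  refine le_trans (csInf_le ?_ ⟨Q, hQ0, rfl⟩) hval
  refine ⟨0, ?_⟩
  rintro _ ⟨Q', -, rfl⟩
  exact add_nonneg (Finset.sum_nonneg fun i _ => by linarith [timeCoupling_su2Rep_le (P.1 i) (Q'.1 i)])
    (Finset.sum_nonneg fun x _ => by
      rw [ConstTube.re_trace_su2Rep_mul_inv_eq_norm]; nlinarith [sq_nonneg ‖su2Quat (P.2 x) - su2Quat (Q'.2 x)‖])

end Summit.QuantumFields.YangMills.Theorems.VirialFluxGap.RegularValley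

end
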